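import Mathlib.Algebra.Polynomial.Bivariate
import Literature.NumberTheory.DiophantineGeometry.BertiniHomogenizationProofs
import HarnessLib

/-!
# The restriction of an irreducible polynomial to the generic plane through a line is irreducible

Let `E` be a field, `f ∈ E[x₁, …, xₙ]` irreducible, and `μ, v ∈ Eⁿ` with `g(X) = f(μ + X v) ≠ 0`.
The restriction of `f` to the planes through the line `{μ + X v}`,

  `χ(X, Y, Z) = f(μ₁ + v₁ X + Z₁ Y, …, μₙ + vₙ X + Zₙ Y)`,

viewed as a polynomial in `X` over `E[Z][Y]` (`Z = (Z₁, …, Zₙ)` the plane parameters), is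
irreducible (`irreducible_planeSubst`). Indeed `χ` is the dilation `f̂(X, Y·Z)` of
`f̂(X, W) = f(μ + v X + W) ∈ E[X][W]`, which is `f` up to the affine change of variables
`W ↦ W - μ - vX` (so irreducible, `irreducible_affineShift`) and has `f̂(X, 0) = g(X) ≠ 0`; the
dilation of such a polynomial is irreducible (`irreducible_dilation`,
`BertiniHomogenizationProofs`), and `χ` is its image under the ring isomorphism
`E[X][Z][Y] ≅ E[Z][Y][X]`.

This is the hypothesis "`χ` is an irreducible element of `K̄[X, Y, Z₂, …, Zₙ]`" of condition (9)
in Cafure–Matera's account (§3.2) of Kaltofen's effective Hilbert irreducibility theorem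
([Kal95, Lemma 4]); it is the input of the Newton–Hensel argument of the sibling Bertini files.
No definitions are introduced: `χ`, `f̂`, `g` are the displayed `MvPolynomial.aeval` terms, with
the convention that in `E[Z][Y][X] = Polynomial (Polynomial (MvPolynomial (Fin n) E))` the outer
variable is `X` and the inner one is `Y`.

## References

* E. Kaltofen, J. Comput. System Sci. 50 (1995) 274–295, §3 Lemma 4. [Kaltofen1995]
* A. Cafure, G. Matera, Finite Fields Appl. 12 (2006) 155–185, §3.2 condition (9). [CafureMatera2006]
-/

noncomputable section

open scoped Classical Polynomial
open MvPolynomial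

namespace Literature.NumberTheory.DiophantineGeometry

universe u

variable {E : Type u} [Field E] {n : ℕ}

/-! ### Constants and base change -/

/-- A constant `C r ∈ A[X]` over a domain is irreducible iff `r` is. (Here: the direction used.)
[folklore] -/
theorem irreducible_C_of_irreducible {A : Type*} [CommRing A] [IsDomain A] {r : A}
    (hr : Irreducible r) : Irreducible (Polynomial.C r) := by
  refine ⟨fun hu ↦ hr.not_isUnit (Polynomial.isUnit_C.1 hu), fun p q hpq ↦ ?_⟩
  have hr0 : r ≠ 0 := hr.ne_zero
  have hp0 : p ≠ 0 := fun h ↦ by rw [h, zero_mul] at hpq; exact hr0 (Polynomial.C_eq_zero.1 hpq)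
  have hq0 : q ≠ 0 := fun h ↦ by rw [h, mul_zero] at hpq; exact hr0 (Polynomial.C_eq_zero.1 hpq)
  have hdeg : p.natDegree + q.natDegree = 0 := by
    rw [← Polynomial.natDegree_mul hp0 hq0, ← hpq, Polynomial.natDegree_C]
  have hp : p = Polynomial.C (p.coeff 0) := Polynomial.eq_C_of_natDegree_eq_zero (by omega)
  have hq : q = Polynomial.C (q.coeff 0) := Polynomial.eq_C_of_natDegree_eq_zero (by omega)
  rw [hp, hq, ← map_mul] at hpq
  have hab : r = p.coeff 0 * q.coeff 0 := Polynomial.C_injective hpq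
  rcases hr.isUnit_or_isUnit hab with hu | hu
  · exact Or.inl (hp ▸ Polynomial.isUnit_C.2 hu)
  · exact Or.inr (hq ▸ Polynomial.isUnit_C.2 hu)

/-- The ring isomorphism `E[X][Z] ≅ E[Z][X]`: `MvPolynomial σ E[X] ≃ (MvPolynomial σ E)[X]`,
`Zᵢ ↦ Zᵢ`, `X ↦ X` (composite of Mathlib's `optionEquivRight` and `optionEquivLeft`), on the
generators. [folklore] -/
theorem optionEquiv_X {σ : Type*} (i : σ) :
    ((optionEquivRight E σ).symm.trans (optionEquivLeft E σ)) (X i) = Polynomial.C (X i) := by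
  rw [AlgEquiv.trans_apply, show (optionEquivRight E σ).symm (X i) = X (some i) from
    (AlgEquiv.symm_apply_eq _).2 (optionEquivRight_X_some (R := E) (S₁ := σ) i).symm, optionEquivLeft_X_some]

/-- The isomorphism `E[X][Z] ≅ E[Z][X]` on coefficients `p(X) ∈ E[X]`. [folklore] -/
theorem optionEquiv_C {σ : Type*} (p : E[X]) :
    ((optionEquivRight E σ).symm.trans (optionEquivLeft E σ)) (C p) =
      p.map (MvPolynomial.C : E →+* MvPolynomial σ E) := by
  set Ψ := (optionEquivRight E σ).symm.trans (optionEquivLeft E σ) with hΨ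
  have h : ((Ψ.toAlgHom : MvPolynomial σ E[X] →+* (MvPolynomial σ E)[X]).comp MvPolynomial.C) =
      Polynomial.mapRingHom MvPolynomial.C := by
    refine Polynomial.ringHom_ext (fun e ↦ ?_) ?_
    · rw [RingHom.comp_apply, Polynomial.coe_mapRingHom, Polynomial.map_C]
      change Ψ (C (Polynomial.C e)) = _
      rw [hΨ, AlgEquiv.trans_apply, show (optionEquivRight E σ).symm (C (Polynomial.C e)) = C e
        from (AlgEquiv.symm_apply_eq _).2 (optionEquivRight_C (R := E) (S₁ := σ) e).symm, optionEquivLeft_C]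
    · rw [RingHom.comp_apply, Polynomial.coe_mapRingHom, Polynomial.map_X]
      change Ψ (C Polynomial.X) = _
      rw [hΨ, AlgEquiv.trans_apply, show (optionEquivRight E σ).symm (C Polynomial.X) = X none
        from (AlgEquiv.symm_apply_eq _).2 (optionEquivRight_X_none (R := E) (S₁ := σ)).symm, optionEquivLeft_X_none]
  exact DFunLike.congr_fun h p

/-- Base change to `E[X]` preserves irreducibility: if `f ∈ E[Z]` is irreducible then so is its
image in `E[X][Z]`. [folklore] -/
theorem irreducible_map_polynomial_C {σ : Type*} {f : MvPolynomial σ E} (hf : Irreducible f) :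
    Irreducible (MvPolynomial.map (Polynomial.C : E →+* E[X]) f) := by
  set Ψ := (optionEquivRight E σ).symm.trans (optionEquivLeft E σ) with hΨ
  have h : Ψ (MvPolynomial.map (Polynomial.C : E →+* E[X]) f) = Polynomial.C f := by
    have h1 : ((Ψ.toAlgHom : MvPolynomial σ E[X] →+* (MvPolynomial σ E)[X]).comp
        (MvPolynomial.map (Polynomial.C : E →+* E[X]))) =
        (Polynomial.C : MvPolynomial σ E →+* (MvPolynomial σ E)[X]).comp
          (RingHom.id (MvPolynomial σ E)) := by
      refine MvPolynomial.ringHom_ext (fun e ↦ ?_) (fun i ↦ ?_)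
      · simp only [RingHom.comp_apply, map_C, RingHom.id_apply]
        change Ψ (C (Polynomial.C e)) = _
        rw [optionEquiv_C, Polynomial.map_C]
      · simp only [RingHom.comp_apply, map_X, RingHom.id_apply]
        exact optionEquiv_X i
    exact DFunLike.congr_fun h1 f
  rw [← MulEquiv.irreducible_iff Ψ, h]
  exact irreducible_C_of_irreducible hf

/-! ### The affine shift `f̂(X, W) = f(μ + vX + W)` -/

/-- **`f̂(X, W) = f(μ + v X + W) ∈ E[X][W]` is irreducible** for `f ∈ E[x]` irreducible: it is the
base change of `f` composed with the `E[X]`-algebra automorphism `Wᵢ ↦ Wᵢ + μᵢ + vᵢ X`.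
[folklore] -/
theorem irreducible_affineShift {f : MvPolynomial (Fin n) E} (hf : Irreducible f)
    (ℓ : Fin n → E[X]) :
    Irreducible (MvPolynomial.aeval (fun i ↦ C (ℓ i) + X i : Fin n → MvPolynomial (Fin n) E[X]) f) := by
  -- the automorphism `β : Wᵢ ↦ Wᵢ + ℓᵢ` of `E[X][W]`
  set β : MvPolynomial (Fin n) E[X] ≃ₐ[E[X]] MvPolynomial (Fin n) E[X] :=
    AlgEquiv.ofAlgHom (aeval fun i ↦ X i + C (ℓ i)) (aeval fun i ↦ X i - C (ℓ i))
      (by refine MvPolynomial.algHom_ext fun i ↦ ?_; simp)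
      (by refine MvPolynomial.algHom_ext fun i ↦ ?_; simp) with hβ
  have h : MvPolynomial.aeval (fun i ↦ C (ℓ i) + X i : Fin n → MvPolynomial (Fin n) E[X]) f =
      β (MvPolynomial.map (Polynomial.C : E →+* E[X]) f) := by
    have h1 : ((MvPolynomial.aeval fun i ↦ C (ℓ i) + X i :
        MvPolynomial (Fin n) E →ₐ[E] MvPolynomial (Fin n) E[X]) : MvPolynomial (Fin n) E →+* _) =
        (β.toAlgHom : MvPolynomial (Fin n) E[X] →+* MvPolynomial (Fin n) E[X]).comp
          (MvPolynomial.map (Polynomial.C : E →+* E[X])) := by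
      refine MvPolynomial.ringHom_ext (fun e ↦ ?_) (fun i ↦ ?_)
      · simp [hβ]
      · simp [hβ, add_comm]
    exact DFunLike.congr_fun h1 f
  rw [h, MulEquiv.irreducible_iff β]
  exact irreducible_map_polynomial_C hf

/-- `f̂(X, 0) = g(X) = f(μ + vX)`: the constant coefficient (in `W`) of the affine shift.
[folklore] -/
theorem coeff_zero_affineShift (f : MvPolynomial (Fin n) E) (ℓ : Fin n → E[X]) :
    coeff 0 (MvPolynomial.aeval (fun i ↦ C (ℓ i) + X i : Fin n → MvPolynomial (Fin n) E[X]) f) =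
      MvPolynomial.aeval ℓ f := by
  have h1 : (constantCoeff : MvPolynomial (Fin n) E[X] →+* E[X]).comp
      (MvPolynomial.aeval (R := E) (fun i ↦ C (ℓ i) + X i : Fin n → MvPolynomial (Fin n) E[X])).toRingHom =
      ((MvPolynomial.aeval (R := E) ℓ).toRingHom : MvPolynomial (Fin n) E →+* E[X]) := by
    refine MvPolynomial.ringHom_ext (fun e ↦ ?_) (fun i ↦ ?_)
    · simp [Polynomial.algebraMap_eq]
    · simp
  rw [← constantCoeff_eq]
  exact DFunLike.congr_fun h1 f

/-! ### The plane restriction `χ = f(μ + vX + Y·Z) ∈ E[Z][Y][X]` -/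

/-- The `E`-algebra isomorphism `E[X][Z][U] ≅ E[Z][Y][X]` (`U ↦ Y` inner, `X ↦ X` outer) used to
read the dilation of `f̂` as the plane restriction `χ`, on the affine-linear generators:
`(μᵢ + vᵢ X) + Zᵢ U ↦ μᵢ + vᵢ X + Zᵢ Y`. [folklore] -/
theorem transport_affine_generator (μ v : E) (i : Fin n) :
    ((Polynomial.mapAlgEquiv
        ((optionEquivRight E (Fin n)).symm.trans (optionEquivLeft E (Fin n)))).trans
      ((Polynomial.Bivariate.swap (R := MvPolynomial (Fin n) E)).restrictScalars E))
      (Polynomial.C (C (Polynomial.C μ + Polynomial.C v * Polynomial.X)) +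
        Polynomial.C (X i) * Polynomial.X : Polynomial (MvPolynomial (Fin n) E[X])) =
      Polynomial.C (Polynomial.C (MvPolynomial.C (μ))) +
        Polynomial.C (Polynomial.C (MvPolynomial.C (v))) * Polynomial.X +
        Polynomial.C (Polynomial.C (MvPolynomial.X i) * Polynomial.X) := by
  set Ψ₀ := (optionEquivRight E (Fin n)).symm.trans (optionEquivLeft E (Fin n)) with hΨ₀
  rw [AlgEquiv.trans_apply, AlgEquiv.restrictScalars_apply, Polynomial.coe_mapAlgEquiv]
  have h1 : Polynomial.map (Ψ₀ : MvPolynomial (Fin n) E[X] →+* (MvPolynomial (Fin n) E)[X])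
      (Polynomial.C (C (Polynomial.C μ + Polynomial.C v * Polynomial.X)) +
        Polynomial.C (X i) * Polynomial.X) =
      Polynomial.C (Polynomial.C (C μ) + Polynomial.C (C v) * Polynomial.X) +
        Polynomial.C (Polynomial.C (X i)) * Polynomial.X := by
    rw [Polynomial.map_add, Polynomial.map_mul, Polynomial.map_C, Polynomial.map_C,
      Polynomial.map_X]
    congr 2
    · change Ψ₀ (C _) = _
      rw [optionEquiv_C, Polynomial.map_add, Polynomial.map_mul, Polynomial.map_C,
        Polynomial.map_C, Polynomial.map_X]
    · change Polynomial.C (Ψ₀ (X i)) = _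
      rw [optionEquiv_X]
  erw [h1]
  rw [map_add, map_mul, Polynomial.Bivariate.swap_C, Polynomial.Bivariate.swap_C_C,
    Polynomial.Bivariate.swap_Y, Polynomial.map_add, Polynomial.map_mul, Polynomial.map_C,
    Polynomial.map_C, Polynomial.map_X, ← map_mul]

/-- **Irreducibility of the plane restriction (Kaltofen's Lemma 4, the irreducibility clause of
Cafure–Matera's condition (9)).** Let `f ∈ E[x₁, …, xₙ]` be irreducible and `μ, v ∈ Eⁿ` with
`g(X) = f(μ + X v) ≠ 0`. Then `χ = f(μ + v X + Y·Z) ∈ E[Z][Y][X]` is irreducible. Proof: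
`χ` is the image under `E[X][Z][U] ≅ E[Z][Y][X]` of the dilation `f̂(X, U·Z)` of the irreducible
`f̂(X, W) = f(μ + vX + W)` with `f̂(X, 0) = g ≠ 0` (`irreducible_dilation`).
[cite: Kaltofen1995, §3 Lemma 4] -/
theorem irreducible_planeSubst {f : MvPolynomial (Fin n) E} (hf : Irreducible f) (μ v : Fin n → E)
    (hg : MvPolynomial.aeval (fun i ↦ Polynomial.C (μ i) + Polynomial.C (v i) * Polynomial.X :
      Fin n → E[X]) f ≠ 0) :
    Irreducible (MvPolynomial.aeval (fun i ↦
      (Polynomial.C (Polynomial.C (MvPolynomial.C (μ i))) +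
        Polynomial.C (Polynomial.C (MvPolynomial.C (v i))) * Polynomial.X +
        Polynomial.C (Polynomial.C (MvPolynomial.X i) * Polynomial.X) :
          Polynomial (Polynomial (MvPolynomial (Fin n) E)))) f) := by
  set ℓ : Fin n → E[X] := fun i ↦ Polynomial.C (μ i) + Polynomial.C (v i) * Polynomial.X with hℓ
  set fhat := MvPolynomial.aeval (fun i ↦ C (ℓ i) + X i : Fin n → MvPolynomial (Fin n) E[X]) f
    with hfhat
  have hirr : Irreducible fhat := irreducible_affineShift hf ℓ
  have h0 : coeff 0 fhat ≠ 0 := by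
    rw [hfhat, coeff_zero_affineShift]
    exact hg
  have hDl := irreducible_dilation hirr h0
  rw [← aeval_C_X_mul_X_eq_sum] at hDl
  -- the dilation of `f̂` is `f(μ + vX + U·Z)` over `E[X][Z][U]`
  set θ₂ : Fin n → Polynomial (MvPolynomial (Fin n) E[X]) :=
    fun i ↦ Polynomial.C (C (ℓ i)) + Polynomial.C (X i) * Polynomial.X with hθ₂
  have hcomp : MvPolynomial.aeval (fun i ↦ Polynomial.C (X i) * Polynomial.X :
      Fin n → Polynomial (MvPolynomial (Fin n) E[X])) fhat = MvPolynomial.aeval θ₂ f := by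
    have h := MvPolynomial.comp_aeval_apply
      (f := (fun i ↦ C (ℓ i) + X i : Fin n → MvPolynomial (Fin n) E[X]))
      ((MvPolynomial.aeval (fun i ↦ Polynomial.C (X i) * Polynomial.X :
        Fin n → Polynomial (MvPolynomial (Fin n) E[X]))).restrictScalars E) f
    rw [AlgHom.coe_restrictScalars'] at h
    have hfun : (fun i ↦ (MvPolynomial.aeval (fun i ↦ Polynomial.C (X i) * Polynomial.X :
        Fin n → Polynomial (MvPolynomial (Fin n) E[X]))) (C (ℓ i) + X i)) = θ₂ := by
      funext i
      simp only [hθ₂, map_add, MvPolynomial.aeval_C, MvPolynomial.aeval_X,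
        Polynomial.algebraMap_apply, MvPolynomial.algebraMap_eq]
    rw [hfhat, h, hfun]
  rw [hcomp] at hDl
  -- transport along `E[X][Z][U] ≅ E[Z][Y][X]`
  set Ψ := (Polynomial.mapAlgEquiv
      ((optionEquivRight E (Fin n)).symm.trans (optionEquivLeft E (Fin n)))).trans
    ((Polynomial.Bivariate.swap (R := MvPolynomial (Fin n) E)).restrictScalars E) with hΨ
  have h2 := MvPolynomial.comp_aeval_apply (f := θ₂) Ψ.toAlgHom f
  have hgen : (fun i ↦ Ψ.toAlgHom (θ₂ i)) = fun i ↦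
      (Polynomial.C (Polynomial.C (MvPolynomial.C (μ i))) +
        Polynomial.C (Polynomial.C (MvPolynomial.C (v i))) * Polynomial.X +
        Polynomial.C (Polynomial.C (MvPolynomial.X i) * Polynomial.X) :
          Polynomial (Polynomial (MvPolynomial (Fin n) E))) := by
    funext i
    exact transport_affine_generator (μ i) (v i) i
  rw [hgen, AlgEquiv.coe_toAlgHom] at h2
  rw [← h2]
  exact (MulEquiv.irreducible_iff Ψ).2 hDl

end Literature.NumberTheory.DiophantineGeometry
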